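/-
Copyright (c) 2026 the pub-hodgecm-mathlib formalisation cell (harness21).  Prover seat hodgecm-mathlib-K2E1-p10 (g2), Track B ∕ K2-LIT (build stream 29), h413 = `stmt-HodgeConjecture-24833`,
route of record `HCCMUnconditional`, ROADCARD «5Res ENDGAME BY FAMILIES» §2 C7; dealer K2E1-plan (g7) deals (155)∕(169) — FILE F3a of the C7 split: TRUNCATION DENSITY in the
square-integrable test class (bounded, compactly-supported-mod-`N` test functions suffice).
-/
import Summits.HodgeConjecture.HodgeConjecture.Theorems.K2E1PseudoEisensteinDensity      -- ★ (H2)-d (K2E1-p02): the test class `𝒯_i`; brings ★ F2b `measurable_tsum_enorm`, `memLp_two_pseudoEisenstein_automorphicQuotient`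
import Mathlib.MeasureTheory.Integral.Lebesgue.Countable
import Mathlib.MeasureTheory.Integral.Lebesgue.DominatedConvergence
import HarnessLib

/-!
# h413 ∕ Track B «K2-LIT», ROADCARD «5Res BY FAMILIES» C7, FILE F3a — helper `K2E1PseudoEisensteinTruncationDensityU`: `[θ_{Ψ·𝟙_{A_n}·𝟙_{|Ψ|≤n}}] → [θ_Ψ]` IN `L²(X)` —
# BOUNDED TEST FUNCTIONS SUPPORTED IN THE SETS OF A RIGHT-`N_i(𝔸)`-STABLE EXHAUSTION ARE DENSE AMONG THE SQUARE-INTEGRABLE PSEUDO-EISENSTEIN CLASSES (generic `𝒢`)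

Cell `pub/hodgecm-mathlib`, crux h413 = `stmt-HodgeConjecture-24833`, route of record `HCCMUnconditional`; dealer K2E1-plan (g7) (155)∕(169), ROADCARD §2 C7 (b).  THEOREMS ONLY (no `def`,
no `instance`, no notation, no named-fact hypothesis, no `sorry`); lane `--supports stmt-HodgeConjecture-24833 --as helper` (count-neutral).  Closes no socket.  GENERIC over ★
`AdelicGroupData 𝒢`, a radical `N_i`, an automorphic `μ`; f1's currency `θ_Φ(x) = Σ'_q Φ(x̃ q̃)`, `𝒯_i` = Borel right-`N_i(𝔸)`-invariant `Φ` with `∫⁻ θ_{|Φ|}² dμ < ∞`.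

THE MATHEMATICS ([MoeglinWaldspurger1995, II.1.2]; [Folland1999, Thm. 2.24–2.25]).  Let `A_n ↑ G(𝔸)` be Borel sets, right-`N_i(𝔸)`-stable.  For `Ψ ∈ 𝒯_i` put `Ψ_n := Ψ·𝟙_{S_n}`,
`S_n := A_n ∩ {|Ψ| ≤ n}` (Borel, right-`N_i(𝔸)`-invariant, `|Ψ_n| ≤ min(n, |Ψ|)`, so `Ψ_n ∈ 𝒯_i`; left-`K`-invariant when `Ψ` and the `A_n` are).  At a.e. `x` the family `q ↦ Ψ(x̃ q̃)`
is absolutely summable (`θ_{|Ψ|} ∈ L²`), so `θ_{Ψ_n}(x) − θ_Ψ(x) = −Σ_q (Ψ·𝟙_{S_nᶜ})(x̃ q̃)` and `|θ_{Ψ_n} − θ_Ψ| ≤ D_n := θ_{|Ψ·𝟙_{S_nᶜ}|}`; `D_n(x) → 0` (dominated convergence in the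
counting sum: each point `x̃ q̃` eventually lies in `S_n`) and `D_n ≤ θ_{|Ψ|}`, so `∫⁻ D_n² dμ → 0` (dominated convergence on `X`) and `‖[θ_{Ψ_n}] − [θ_Ψ]‖₂ → 0`.  Consequently the classes
`[θ_Φ]` of BOUNDED test functions supported in some `A_n` (and left-`K`-invariant) have the same closed span as all of `Θ^{K}` (★ F2b) — FILE F3b periodises such `Φ` over the
rational torus with locally finite sums.

* §1 `measurable_truncate`, `truncate_mul_radical`, `norm_truncate_le`, `norm_truncate_le_norm`, `truncate_eq_zero_of_not_mem`, `truncate_mul_left`, `lintegral_tsum_enorm_truncate_sq_lt_top`.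
* §2 `tendsto_tsum_enorm_compl_indicator` (the counting-sum dominated convergence at a good `x`), `tendsto_lintegral_tsum_enorm_compl_indicator_sq`.
* §3 **`tendsto_toLp_pseudoEisenstein_truncate`** (`[θ_{Ψ_n}] → [θ_Ψ]` in `L²`), **`toLp_pseudoEisenstein_mem_closure_of_truncate_mem`** (density corollary for any set containing the truncations).

HONEST LABEL: HC_CM is proved only modulo the 7 printed citations (2 remaining named inputs: hLiu418 = `stmt-HodgeConjecture-24832`, h413 = `stmt-HodgeConjecture-24833`) until rung 0
closes; this file asserts no named fact and closes no socket.
References: [MoeglinWaldspurger1995] C. Mœglin, J.-L. Waldspurger, *Spectral Decomposition and Eisenstein Series*, II.1.2; [Folland1999] G. B. Folland, *Real Analysis*, Thm. 2.24 (dominated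
convergence), Prop. 6.10; [BorelJacquet1979] A. Borel, H. Jacquet, *Automorphic forms and automorphic representations*, §4.6.
-/

set_option autoImplicit false
set_option linter.dupNamespace false  -- the mandated namespace repeats the summit's segment (`HodgeConjecture.HodgeConjecture`)

noncomputable section

open MeasureTheory Measure Set Filter Topology
open Literature.MeasureTheory.Group Literature.NumberTheory.Automorphic ContRepresentation
open Summit.HodgeConjecture.HodgeConjecture.Cruxes.H413.K2E1PseudoEisensteinCuspOrthogonal
open scoped ENNReal NNReal Pointwise

namespace Summit.HodgeConjecture.HodgeConjecture.Cruxes.H413.K2E1PseudoEisensteinTruncationDensityU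

universe u

variable {K : Type} [Field K] [NumberField K] (𝒢 : AdelicGroupData.{u} K)
  [MeasurableSpace 𝒢.Adelic] [BorelSpace 𝒢.Adelic] [LocallyCompactSpace 𝒢.Adelic] [SecondCountableTopology 𝒢.Adelic] [T2Space 𝒢.Adelic]
  [DiscreteTopology 𝒢.quotientSubgroup] (𝔓 : 𝒢.ParabolicUnipotentData) (i : 𝔓.ι)
  (μ : Measure 𝒢.automorphicQuotient) [𝒢.IsAutomorphicMeasure μ]
  (A : ℕ → Set 𝒢.Adelic)

/-! ## §1 The truncations `Ψ_n = Ψ·𝟙_{A_n ∩ {|Ψ| ≤ n}}` are bounded members of `𝒯_i` supported in `A_n` -/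

omit [BorelSpace 𝒢.Adelic] [LocallyCompactSpace 𝒢.Adelic] [SecondCountableTopology 𝒢.Adelic] [T2Space 𝒢.Adelic] [DiscreteTopology 𝒢.quotientSubgroup] in
/-- `Ψ_n` is Borel. [folklore] -/
theorem measurable_truncate (hAm : ∀ n, MeasurableSet (A n)) {Ψ : 𝒢.Adelic → ℂ} (hΨm : Measurable Ψ) (n : ℕ) :
    Measurable ((A n ∩ {g | ‖Ψ g‖ ≤ n}).indicator Ψ) :=
  hΨm.indicator ((hAm n).inter (measurableSet_le hΨm.norm measurable_const))

omit [MeasurableSpace 𝒢.Adelic] [BorelSpace 𝒢.Adelic] [LocallyCompactSpace 𝒢.Adelic] [SecondCountableTopology 𝒢.Adelic] [T2Space 𝒢.Adelic] [DiscreteTopology 𝒢.quotientSubgroup] in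
/-- `Ψ_n` is right-`N_i(𝔸)`-invariant when `Ψ` is and the `A_n` are right-`N_i(𝔸)`-stable. [cite: MoeglinWaldspurger1995, II.1.2] -/
theorem truncate_mul_radical (hAN : ∀ n (g : 𝒢.Adelic) (u : 𝔓.radical i), g ∈ A n → g * u ∈ A n) {Ψ : 𝒢.Adelic → ℂ} (hΨ : ∀ (g : 𝒢.Adelic) (u : 𝔓.radical i), Ψ (g * u) = Ψ g) (n : ℕ) :
    ∀ (g : 𝒢.Adelic) (u : 𝔓.radical i), (A n ∩ {g | ‖Ψ g‖ ≤ n}).indicator Ψ (g * u) = (A n ∩ {g | ‖Ψ g‖ ≤ n}).indicator Ψ g := by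
  intro g u
  have hmem : g * u ∈ A n ∩ {g | ‖Ψ g‖ ≤ n} ↔ g ∈ A n ∩ {g | ‖Ψ g‖ ≤ n} := by
    simp only [mem_inter_iff, mem_setOf_eq, hΨ g u]
    refine and_congr_left fun _ => ⟨fun h => ?_, hAN n g u⟩
    have h' := hAN n (g * u) u⁻¹ h
    rwa [Subgroup.coe_inv, mul_assoc, mul_inv_cancel, mul_one] at h'
  by_cases hg : g ∈ A n ∩ {g | ‖Ψ g‖ ≤ n}
  · rw [indicator_of_mem hg, indicator_of_mem (hmem.2 hg), hΨ g u]
  · rw [indicator_of_notMem hg, indicator_of_notMem fun h => hg (hmem.1 h)]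

omit [MeasurableSpace 𝒢.Adelic] [BorelSpace 𝒢.Adelic] [LocallyCompactSpace 𝒢.Adelic] [SecondCountableTopology 𝒢.Adelic] [T2Space 𝒢.Adelic] [DiscreteTopology 𝒢.quotientSubgroup] in
/-- `|Ψ_n| ≤ n`. [folklore] -/
theorem norm_truncate_le (Ψ : 𝒢.Adelic → ℂ) (n : ℕ) (g : 𝒢.Adelic) : ‖(A n ∩ {g | ‖Ψ g‖ ≤ n}).indicator Ψ g‖ ≤ n := by
  by_cases hg : g ∈ A n ∩ {g | ‖Ψ g‖ ≤ n}
  · rw [indicator_of_mem hg]; exact hg.2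
  · rw [indicator_of_notMem hg, norm_zero]; exact n.cast_nonneg

omit [MeasurableSpace 𝒢.Adelic] [BorelSpace 𝒢.Adelic] [LocallyCompactSpace 𝒢.Adelic] [SecondCountableTopology 𝒢.Adelic] [T2Space 𝒢.Adelic] [DiscreteTopology 𝒢.quotientSubgroup] in
/-- `|Ψ_n| ≤ |Ψ|`. [folklore] -/
theorem norm_truncate_le_norm (Ψ : 𝒢.Adelic → ℂ) (n : ℕ) (g : 𝒢.Adelic) : ‖(A n ∩ {g | ‖Ψ g‖ ≤ n}).indicator Ψ g‖ ≤ ‖Ψ g‖ :=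
  norm_indicator_le_norm_self _ _

omit [MeasurableSpace 𝒢.Adelic] [BorelSpace 𝒢.Adelic] [LocallyCompactSpace 𝒢.Adelic] [SecondCountableTopology 𝒢.Adelic] [T2Space 𝒢.Adelic] [DiscreteTopology 𝒢.quotientSubgroup] in
/-- `Ψ_n` vanishes off `A_n`. [folklore] -/
theorem truncate_eq_zero_of_not_mem (Ψ : 𝒢.Adelic → ℂ) (n : ℕ) {g : 𝒢.Adelic} (hg : g ∉ A n) : (A n ∩ {g | ‖Ψ g‖ ≤ n}).indicator Ψ g = 0 :=
  indicator_of_notMem (fun h => hg h.1) _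

omit [MeasurableSpace 𝒢.Adelic] [BorelSpace 𝒢.Adelic] [LocallyCompactSpace 𝒢.Adelic] [SecondCountableTopology 𝒢.Adelic] [T2Space 𝒢.Adelic] [DiscreteTopology 𝒢.quotientSubgroup] in
/-- `Ψ_n` is left-`K`-invariant when `Ψ` is and the `A_n` are left-`K`-stable (`K` acting through any map `ι`). [folklore] -/
theorem truncate_mul_left {Kc : Type*} (ι : Kc → 𝒢.Adelic) (hAK : ∀ n (k : Kc) (g : 𝒢.Adelic), g ∈ A n ↔ ι k * g ∈ A n)
    {Ψ : 𝒢.Adelic → ℂ} (hK : ∀ (k : Kc) (g : 𝒢.Adelic), Ψ (ι k * g) = Ψ g) (n : ℕ) (k : Kc) (g : 𝒢.Adelic) :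
    (A n ∩ {g | ‖Ψ g‖ ≤ n}).indicator Ψ (ι k * g) = (A n ∩ {g | ‖Ψ g‖ ≤ n}).indicator Ψ g := by
  have hmem : ι k * g ∈ A n ∩ {g | ‖Ψ g‖ ≤ n} ↔ g ∈ A n ∩ {g | ‖Ψ g‖ ≤ n} := by
    simp only [mem_inter_iff, mem_setOf_eq, hK k g, ← hAK n k g]
  by_cases hg : g ∈ A n ∩ {g | ‖Ψ g‖ ≤ n}
  · rw [indicator_of_mem hg, indicator_of_mem (hmem.2 hg), hK k g]
  · rw [indicator_of_notMem hg, indicator_of_notMem fun h => hg (hmem.1 h)]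

omit [MeasurableSpace 𝒢.Adelic] [BorelSpace 𝒢.Adelic] [LocallyCompactSpace 𝒢.Adelic] [SecondCountableTopology 𝒢.Adelic] [T2Space 𝒢.Adelic] [DiscreteTopology 𝒢.quotientSubgroup]
  [𝒢.IsAutomorphicMeasure μ] in
/-- `Ψ_n ∈ 𝒯_i`: `∫⁻ θ_{|Ψ_n|}² dμ ≤ ∫⁻ θ_{|Ψ|}² dμ < ∞`. [cite: MoeglinWaldspurger1995, II.1.2] -/
theorem lintegral_tsum_enorm_truncate_sq_lt_top {Ψ : 𝒢.Adelic → ℂ} (n : ℕ)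
    (h2 : ∫⁻ x, (∑' q : 𝒢.quotientSubgroup ⧸ (𝔓.radical i).subgroupOf 𝒢.quotientSubgroup,
        ‖Ψ ((Quotient.out x : 𝒢.Adelic) * ((q.out : 𝒢.quotientSubgroup) : 𝒢.Adelic))‖ₑ) ^ 2 ∂μ < ∞) :
    ∫⁻ x, (∑' q : 𝒢.quotientSubgroup ⧸ (𝔓.radical i).subgroupOf 𝒢.quotientSubgroup,
        ‖(A n ∩ {g | ‖Ψ g‖ ≤ n}).indicator Ψ ((Quotient.out x : 𝒢.Adelic) * ((q.out : 𝒢.quotientSubgroup) : 𝒢.Adelic))‖ₑ) ^ 2 ∂μ < ∞ := by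
  refine lt_of_le_of_lt (lintegral_mono fun x => pow_le_pow_left₀ bot_le (ENNReal.tsum_le_tsum fun q => ?_) 2) h2
  rw [enorm_indicator_eq_indicator_enorm]
  exact indicator_le_self _ _ _

/-! ## §2 Dominated convergence: `D_n = θ_{|Ψ·𝟙_{S_nᶜ}|} → 0` pointwise a.e. and in `∫⁻ (·)² dμ` -/

omit [MeasurableSpace 𝒢.Adelic] [BorelSpace 𝒢.Adelic] [LocallyCompactSpace 𝒢.Adelic] [SecondCountableTopology 𝒢.Adelic] [T2Space 𝒢.Adelic] [DiscreteTopology 𝒢.quotientSubgroup]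
  [𝒢.IsAutomorphicMeasure μ] in
/-- **AT A GOOD `x`, `D_n(x) = Σ'_q |(Ψ·𝟙_{S_nᶜ})(x̃ q̃)| → 0`**: each point `x̃ q̃` lies in `S_n = A_n ∩ {|Ψ| ≤ n}` for all large `n` (`A_n ↑ G(𝔸)`), and the terms are dominated by the
summable `|Ψ(x̃ q̃)|` (dominated convergence for the counting measure). [cite: Folland1999, Thm. 2.24] -/
theorem tendsto_tsum_enorm_compl_indicator (hAmono : Monotone A) (hAU : ∀ g : 𝒢.Adelic, ∃ n, g ∈ A n) (Ψ : 𝒢.Adelic → ℂ) {x : 𝒢.automorphicQuotient}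
    (hx : (∑' q : 𝒢.quotientSubgroup ⧸ (𝔓.radical i).subgroupOf 𝒢.quotientSubgroup, ‖Ψ ((Quotient.out x : 𝒢.Adelic) * ((q.out : 𝒢.quotientSubgroup) : 𝒢.Adelic))‖ₑ) < ∞) :
    Tendsto (fun n : ℕ => ∑' q : 𝒢.quotientSubgroup ⧸ (𝔓.radical i).subgroupOf 𝒢.quotientSubgroup,
        ‖(A n ∩ {g | ‖Ψ g‖ ≤ n})ᶜ.indicator Ψ ((Quotient.out x : 𝒢.Adelic) * ((q.out : 𝒢.quotientSubgroup) : 𝒢.Adelic))‖ₑ) atTop (𝓝 0) := by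
  letI : MeasurableSpace (𝒢.quotientSubgroup ⧸ (𝔓.radical i).subgroupOf 𝒢.quotientSubgroup) := ⊤
  -- rewrite the counting sums as integrals against the counting measure
  have hcount : ∀ f : (𝒢.quotientSubgroup ⧸ (𝔓.radical i).subgroupOf 𝒢.quotientSubgroup) → ℝ≥0∞, (∑' q, f q) = ∫⁻ q, f q ∂Measure.count := fun f =>
    (lintegral_count' (measurable_from_top (f := f))).symm
  simp_rw [hcount]
  rw [hcount] at hx
  rw [← lintegral_zero]
  refine tendsto_lintegral_of_dominated_convergence (fun q => ‖Ψ ((Quotient.out x : 𝒢.Adelic) * ((q.out : 𝒢.quotientSubgroup) : 𝒢.Adelic))‖ₑ)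
    (fun n => measurable_from_top) (fun n => Eventually.of_forall fun q => ?_) hx.ne (Eventually.of_forall fun q => ?_)
  · dsimp only
    rw [enorm_indicator_eq_indicator_enorm]
    exact indicator_le_self _ _ _
  · -- eventually the point lies in `S_n`, where the complementary indicator vanishes
    obtain ⟨n₁, hn₁⟩ := hAU ((Quotient.out x : 𝒢.Adelic) * ((q.out : 𝒢.quotientSubgroup) : 𝒢.Adelic))
    obtain ⟨n₂, hn₂⟩ := exists_nat_ge ‖Ψ ((Quotient.out x : 𝒢.Adelic) * ((q.out : 𝒢.quotientSubgroup) : 𝒢.Adelic))‖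
    refine tendsto_atTop_of_eventually_const (i₀ := max n₁ n₂) fun n hn => ?_
    have hmem : (Quotient.out x : 𝒢.Adelic) * ((q.out : 𝒢.quotientSubgroup) : 𝒢.Adelic) ∈ A n ∩ {g | ‖Ψ g‖ ≤ n} :=
      ⟨hAmono ((le_max_left _ _).trans hn) hn₁, hn₂.trans (by exact_mod_cast (le_max_right _ _).trans hn)⟩
    rw [indicator_of_notMem (fun h => (mem_compl_iff _ _).1 h hmem), enorm_zero]

omit [𝒢.IsAutomorphicMeasure μ] in
/-- **`∫⁻ D_n² dμ → 0`** (dominated convergence on `X`: `D_n ≤ θ_{|Ψ|}`, `θ_{|Ψ|}² ∈ L¹`, and `D_n → 0` at a.e. `x` — those with `θ_{|Ψ|}(x) < ∞`). [cite: Folland1999, Thm. 2.24] -/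
theorem tendsto_lintegral_tsum_enorm_compl_indicator_sq (hAm : ∀ n, MeasurableSet (A n)) (hAmono : Monotone A) (hAU : ∀ g : 𝒢.Adelic, ∃ n, g ∈ A n)
    (hAN : ∀ n (g : 𝒢.Adelic) (u : 𝔓.radical i), g ∈ A n → g * u ∈ A n)
    {Ψ : 𝒢.Adelic → ℂ} (hΨm : Measurable Ψ) (hΨ : ∀ (g : 𝒢.Adelic) (u : 𝔓.radical i), Ψ (g * u) = Ψ g)
    (h2 : ∫⁻ x, (∑' q : 𝒢.quotientSubgroup ⧸ (𝔓.radical i).subgroupOf 𝒢.quotientSubgroup,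
        ‖Ψ ((Quotient.out x : 𝒢.Adelic) * ((q.out : 𝒢.quotientSubgroup) : 𝒢.Adelic))‖ₑ) ^ 2 ∂μ < ∞) :
    Tendsto (fun n : ℕ => ∫⁻ x, (∑' q : 𝒢.quotientSubgroup ⧸ (𝔓.radical i).subgroupOf 𝒢.quotientSubgroup,
        ‖(A n ∩ {g | ‖Ψ g‖ ≤ n})ᶜ.indicator Ψ ((Quotient.out x : 𝒢.Adelic) * ((q.out : 𝒢.quotientSubgroup) : 𝒢.Adelic))‖ₑ) ^ 2 ∂μ) atTop (𝓝 0) := by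
  -- measurability of the θ-majorants (★ F2b `measurable_tsum_enorm`)
  have hθm : ∀ {Φ : 𝒢.Adelic → ℂ}, Measurable Φ → (∀ (g : 𝒢.Adelic) (u : 𝔓.radical i), Φ (g * u) = Φ g) →
      Measurable fun x : 𝒢.automorphicQuotient => ∑' q : 𝒢.quotientSubgroup ⧸ (𝔓.radical i).subgroupOf 𝒢.quotientSubgroup,
        ‖Φ ((Quotient.out x : 𝒢.Adelic) * ((q.out : 𝒢.quotientSubgroup) : 𝒢.Adelic))‖ₑ := fun hΦm hΦ => by
    letI := AdelicGroupData.measurableSpaceQuotientForm 𝒢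
    haveI := AdelicGroupData.borelSpaceQuotientForm 𝒢
    exact measurable_tsum_enorm 𝒢.quotientSubgroup (𝔓.radical i) hΦm hΦ
  -- the complementary truncations `Ψ·𝟙_{S_nᶜ}` are Borel and right-`N_i(𝔸)`-invariant
  have hRm : ∀ n, Measurable ((A n ∩ {g | ‖Ψ g‖ ≤ n})ᶜ.indicator Ψ) := fun n =>
    hΨm.indicator ((hAm n).inter (measurableSet_le hΨm.norm measurable_const)).compl
  have hR : ∀ n (g : 𝒢.Adelic) (u : 𝔓.radical i), (A n ∩ {g | ‖Ψ g‖ ≤ n})ᶜ.indicator Ψ (g * u) = (A n ∩ {g | ‖Ψ g‖ ≤ n})ᶜ.indicator Ψ g := fun n g u => by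
    rw [indicator_compl, Pi.sub_apply, Pi.sub_apply, hΨ g u, truncate_mul_radical 𝒢 𝔓 i A hAN hΨ n g u]
  rw [← lintegral_zero]
  refine tendsto_lintegral_of_dominated_convergence
    (fun x => (∑' q : 𝒢.quotientSubgroup ⧸ (𝔓.radical i).subgroupOf 𝒢.quotientSubgroup, ‖Ψ ((Quotient.out x : 𝒢.Adelic) * ((q.out : 𝒢.quotientSubgroup) : 𝒢.Adelic))‖ₑ) ^ 2)
    (fun n => (hθm (hRm n) (hR n)).pow_const 2) (fun n => Eventually.of_forall fun x => pow_le_pow_left₀ bot_le (ENNReal.tsum_le_tsum fun q => ?_) 2) h2.ne ?_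
  · rw [enorm_indicator_eq_indicator_enorm]
    exact indicator_le_self _ _ _
  · -- a.e. `x`: `θ_{|Ψ|}(x) < ∞`
    have hfin : ∀ᵐ x ∂μ, (∑' q : 𝒢.quotientSubgroup ⧸ (𝔓.radical i).subgroupOf 𝒢.quotientSubgroup,
        ‖Ψ ((Quotient.out x : 𝒢.Adelic) * ((q.out : 𝒢.quotientSubgroup) : 𝒢.Adelic))‖ₑ) < ∞ := by
      filter_upwards [ae_lt_top ((hθm hΨm hΨ).pow_const 2) h2.ne] with x hx
      exact lt_top_iff_ne_top.2 fun h => (lt_top_iff_ne_top.1 hx) (by rw [h, ENNReal.top_pow]; exact two_ne_zero)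
    filter_upwards [hfin] with x hx
    have h := ((ENNReal.continuous_pow 2).tendsto 0).comp (tendsto_tsum_enorm_compl_indicator 𝒢 𝔓 i A hAmono hAU Ψ hx)
    rw [zero_pow two_ne_zero] at h
    exact h

/-! ## §3 `[θ_{Ψ_n}] → [θ_Ψ]` in `L²(X)` and the density corollary -/

/-- **`[θ_{Ψ_n}] → [θ_Ψ]` IN `L²(X, μ)`**: `‖θ_{Ψ_n} − θ_Ψ‖ ≤ D_n` a.e. (the difference of two absolutely convergent sums is the sum over `S_nᶜ`), `eLpNorm ≤ (∫⁻ D_n²)^{1∕2} → 0` (§2).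
[cite: MoeglinWaldspurger1995, II.1.2] [cite: Folland1999, Thm. 2.24] -/
theorem tendsto_toLp_pseudoEisenstein_truncate (hAm : ∀ n, MeasurableSet (A n)) (hAmono : Monotone A) (hAU : ∀ g : 𝒢.Adelic, ∃ n, g ∈ A n)
    (hAN : ∀ n (g : 𝒢.Adelic) (u : 𝔓.radical i), g ∈ A n → g * u ∈ A n)
    {Ψ : 𝒢.Adelic → ℂ} (hΨm : Measurable Ψ) (hΨ : ∀ (g : 𝒢.Adelic) (u : 𝔓.radical i), Ψ (g * u) = Ψ g)
    (h2 : ∫⁻ x, (∑' q : 𝒢.quotientSubgroup ⧸ (𝔓.radical i).subgroupOf 𝒢.quotientSubgroup,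
        ‖Ψ ((Quotient.out x : 𝒢.Adelic) * ((q.out : 𝒢.quotientSubgroup) : 𝒢.Adelic))‖ₑ) ^ 2 ∂μ < ∞) :
    Tendsto (fun n : ℕ => (memLp_two_pseudoEisenstein_automorphicQuotient 𝒢 𝔓 i μ (measurable_truncate 𝒢 A hAm hΨm n) (truncate_mul_radical 𝒢 𝔓 i A hAN hΨ n)
        (lintegral_tsum_enorm_truncate_sq_lt_top 𝒢 𝔓 i μ A n h2)).toLp _)
      atTop (𝓝 ((memLp_two_pseudoEisenstein_automorphicQuotient 𝒢 𝔓 i μ hΨm hΨ h2).toLp _)) := by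
  rw [Lp.tendsto_Lp_iff_tendsto_eLpNorm'']
  -- measurability of the θ-majorant of `Ψ`
  have hθm : Measurable fun x : 𝒢.automorphicQuotient => ∑' q : 𝒢.quotientSubgroup ⧸ (𝔓.radical i).subgroupOf 𝒢.quotientSubgroup,
      ‖Ψ ((Quotient.out x : 𝒢.Adelic) * ((q.out : 𝒢.quotientSubgroup) : 𝒢.Adelic))‖ₑ := by
    letI := AdelicGroupData.measurableSpaceQuotientForm 𝒢
    haveI := AdelicGroupData.borelSpaceQuotientForm 𝒢
    exact measurable_tsum_enorm 𝒢.quotientSubgroup (𝔓.radical i) hΨm hΨ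
  -- a.e. pointwise domination `‖θ_{Ψ_n} − θ_Ψ‖ₑ ≤ D_n`
  have hdom : ∀ n, ∀ᵐ x ∂μ, ‖((fun x : 𝒢.automorphicQuotient => ∑' q : 𝒢.quotientSubgroup ⧸ (𝔓.radical i).subgroupOf 𝒢.quotientSubgroup,
        (A n ∩ {g | ‖Ψ g‖ ≤ n}).indicator Ψ ((Quotient.out x : 𝒢.Adelic) * ((q.out : 𝒢.quotientSubgroup) : 𝒢.Adelic))) -
        fun x : 𝒢.automorphicQuotient => ∑' q : 𝒢.quotientSubgroup ⧸ (𝔓.radical i).subgroupOf 𝒢.quotientSubgroup,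
          Ψ ((Quotient.out x : 𝒢.Adelic) * ((q.out : 𝒢.quotientSubgroup) : 𝒢.Adelic))) x‖ₑ ≤
      ∑' q : 𝒢.quotientSubgroup ⧸ (𝔓.radical i).subgroupOf 𝒢.quotientSubgroup,
        ‖(A n ∩ {g | ‖Ψ g‖ ≤ n})ᶜ.indicator Ψ ((Quotient.out x : 𝒢.Adelic) * ((q.out : 𝒢.quotientSubgroup) : 𝒢.Adelic))‖ₑ := by
    intro n
    have hfin : ∀ᵐ x ∂μ, (∑' q : 𝒢.quotientSubgroup ⧸ (𝔓.radical i).subgroupOf 𝒢.quotientSubgroup,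
        ‖Ψ ((Quotient.out x : 𝒢.Adelic) * ((q.out : 𝒢.quotientSubgroup) : 𝒢.Adelic))‖ₑ) < ∞ := by
      filter_upwards [ae_lt_top (hθm.pow_const 2) h2.ne] with x hx
      exact lt_top_iff_ne_top.2 fun h => (lt_top_iff_ne_top.1 hx) (by rw [h, ENNReal.top_pow]; exact two_ne_zero)
    filter_upwards [hfin] with x hx
    -- absolute summability at `x`
    have hs' : Summable fun q : 𝒢.quotientSubgroup ⧸ (𝔓.radical i).subgroupOf 𝒢.quotientSubgroup => ‖Ψ ((Quotient.out x : 𝒢.Adelic) * ((q.out : 𝒢.quotientSubgroup) : 𝒢.Adelic))‖₊ := by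
      refine ENNReal.tsum_coe_ne_top_iff_summable.1 ?_
      simpa only [enorm_eq_nnnorm] using hx.ne
    have hsΨ : Summable fun q : 𝒢.quotientSubgroup ⧸ (𝔓.radical i).subgroupOf 𝒢.quotientSubgroup => Ψ ((Quotient.out x : 𝒢.Adelic) * ((q.out : 𝒢.quotientSubgroup) : 𝒢.Adelic)) :=
      .of_nnnorm hs'
    have hsT : Summable fun q : 𝒢.quotientSubgroup ⧸ (𝔓.radical i).subgroupOf 𝒢.quotientSubgroup =>
        (A n ∩ {g | ‖Ψ g‖ ≤ n}).indicator Ψ ((Quotient.out x : 𝒢.Adelic) * ((q.out : 𝒢.quotientSubgroup) : 𝒢.Adelic)) :=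
      .of_nnnorm_bounded hs' fun q => by rw [nnnorm_indicator_eq_indicator_nnnorm]; exact indicator_le_self _ _ _
    rw [Pi.sub_apply, ← hsT.tsum_sub hsΨ]
    refine (enorm_tsum_le_tsum_enorm).trans (le_of_eq (tsum_congr fun q => ?_))
    rw [indicator_compl, Pi.sub_apply, ← enorm_neg, neg_sub]
  -- `eLpNorm ≤ (∫⁻ D_n²)^{1/2} → 0`
  have hupper : Tendsto (fun n : ℕ => (∫⁻ x, (∑' q : 𝒢.quotientSubgroup ⧸ (𝔓.radical i).subgroupOf 𝒢.quotientSubgroup,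
      ‖(A n ∩ {g | ‖Ψ g‖ ≤ n})ᶜ.indicator Ψ ((Quotient.out x : 𝒢.Adelic) * ((q.out : 𝒢.quotientSubgroup) : 𝒢.Adelic))‖ₑ) ^ 2 ∂μ) ^ (1 / (2 : ℝ))) atTop (𝓝 0) := by
    have h := ((ENNReal.continuous_rpow_const (y := 1 / (2 : ℝ))).tendsto 0).comp (tendsto_lintegral_tsum_enorm_compl_indicator_sq 𝒢 𝔓 i μ A hAm hAmono hAU hAN hΨm hΨ h2)
    rwa [ENNReal.zero_rpow_of_pos (by norm_num : (0 : ℝ) < 1 / 2)] at h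
  refine tendsto_of_tendsto_of_tendsto_of_le_of_le tendsto_const_nhds hupper (fun _ => bot_le) fun n => ?_
  rw [eLpNorm_eq_lintegral_rpow_enorm_toReal two_ne_zero ENNReal.ofNat_ne_top, ENNReal.toReal_ofNat]
  refine ENNReal.rpow_le_rpow (lintegral_mono_ae ((hdom n).mono fun x hx => ?_)) (by norm_num)
  rw [ENNReal.rpow_two]
  exact pow_le_pow_left₀ bot_le hx 2

/-- **DENSITY COROLLARY**: `[θ_Ψ]` lies in the closure of any set `S ⊆ L²(X)` containing the classes `[θ_{Ψ_n}]` of all its truncations — so in ★ F2b's head the generators may be restricted to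
BOUNDED test functions supported in the sets `A_n` of any right-`N_i(𝔸)`-stable Borel exhaustion (and left-`K`-invariant when the `A_n` are left-`K`-stable, `truncate_mul_left`).
[cite: MoeglinWaldspurger1995, II.1.2] -/
theorem toLp_pseudoEisenstein_mem_closure_of_truncate_mem (hAm : ∀ n, MeasurableSet (A n)) (hAmono : Monotone A) (hAU : ∀ g : 𝒢.Adelic, ∃ n, g ∈ A n)
    (hAN : ∀ n (g : 𝒢.Adelic) (u : 𝔓.radical i), g ∈ A n → g * u ∈ A n)
    {Ψ : 𝒢.Adelic → ℂ} (hΨm : Measurable Ψ) (hΨ : ∀ (g : 𝒢.Adelic) (u : 𝔓.radical i), Ψ (g * u) = Ψ g)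
    (h2 : ∫⁻ x, (∑' q : 𝒢.quotientSubgroup ⧸ (𝔓.radical i).subgroupOf 𝒢.quotientSubgroup,
        ‖Ψ ((Quotient.out x : 𝒢.Adelic) * ((q.out : 𝒢.quotientSubgroup) : 𝒢.Adelic))‖ₑ) ^ 2 ∂μ < ∞)
    {S : Set (𝒢.L2 μ)} (hS : ∀ n : ℕ, (memLp_two_pseudoEisenstein_automorphicQuotient 𝒢 𝔓 i μ (measurable_truncate 𝒢 A hAm hΨm n) (truncate_mul_radical 𝒢 𝔓 i A hAN hΨ n)
        (lintegral_tsum_enorm_truncate_sq_lt_top 𝒢 𝔓 i μ A n h2)).toLp _ ∈ S) :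
    (memLp_two_pseudoEisenstein_automorphicQuotient 𝒢 𝔓 i μ hΨm hΨ h2).toLp _ ∈ closure S :=
  mem_closure_of_tendsto (tendsto_toLp_pseudoEisenstein_truncate 𝒢 𝔓 i μ A hAm hAmono hAU hAN hΨm hΨ h2) (Eventually.of_forall hS)

end Summit.HodgeConjecture.HodgeConjecture.Cruxes.H413.K2E1PseudoEisensteinTruncationDensityU

end
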